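import Literature.MathematicalPhysics.QuantumFieldTheory.Balaban1983to89.B6CubeInDecayV1L0
import Literature.MathematicalPhysics.QuantumFieldTheory.Balaban1983to89.B6CubeRightLegsV1
import Literature.MathematicalPhysics.QuantumFieldTheory.Balaban1983to89.B6Ineq2133GDivLapTwoScaleV1
import HarnessLib
import Literature.MathematicalPhysics.QuantumFieldTheory.Balaban1983to89.B6Cover236MultiLevelBlocksL0
import Literature.MathematicalPhysics.QuantumFieldTheory.Balaban1983to89.B6CubeWindowV1L0
import Literature.MathematicalPhysics.QuantumFieldTheory.Balaban1983to89.B6Eq292MemberTorusV1L0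
import Literature.MathematicalPhysics.QuantumFieldTheory.Balaban1983to89.B6Geom246MultiLevelBoxL0
import Literature.MathematicalPhysics.QuantumFieldTheory.Balaban1983to89.B6Geom246MultiLevelTorusL0
import Literature.MathematicalPhysics.QuantumFieldTheory.Balaban1983to89.B6GlobalChartV1L0
import Literature.MathematicalPhysics.QuantumFieldTheory.Balaban1983to89.B6InDecayWindowV1L0
import Literature.MathematicalPhysics.QuantumFieldTheory.Balaban1983to89.B6InMajorantTransplantL0
import Literature.MathematicalPhysics.QuantumFieldTheory.Balaban1983to89.B6MultiLevelTorusOperatorL0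
import Literature.MathematicalPhysics.QuantumFieldTheory.Balaban1983to89.B6Prop26KLevelSkeletonV1L0
import Literature.MathematicalPhysics.QuantumFieldTheory.Balaban1983to89.B6TranslateTorusV1L0

/-!
# `Balaban1983to89.B6CubeRightLegsV1L0` — LEVEL-0 TWIN (programme G-F3′-L0, director-ym LINE №27 / UV3-NODE §24.5; plan `lit-balaban-r03/G-F3L0-PLAN.md`) of `B6CubeRightLegsV1`:
the same declarations, SAME NAMES AND STATEMENTS, for nested families WITH print's region `Λ₀ = T ∖ Ω₁` ADMITTED (structures
`B6MultiLevelBoxOperatorL0.Domains` / `B6MultiLevelTorusOperatorL0.TDomains`: levels `0, …, k`, the level-`0` block a single site, `Q′₀ = id`,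
finite weight `a₀` — print p.225 (2.14) «Σ_{j=0}^k … (Q′₀λ)(x) = λ(x), x ∈ Λ₀», p.229 «taking a sequence (2.1) … smallest possible domains B^j(Λ_j),
and considering the operator Δ_a defined by (2.19), (2.20) for this sequence»).  Every `D`-free object is the lineage's, consumed BY NAME; no existing
module is touched; no fact is minted.  Unit `lit-balaban-p33` (p33 gen 101; programme RIGHT-ENTRY-L0 = the (2.136)₃ right-factor chain at level 0, the input of [B9] Thm 3.3's right entry (3.42)₃ for the bond-sector cube letter G_□(1), cell GAPS G-B9-02; port tooling by r03 gen 36–37); B6 fold owner r03; referee ref-4.  THE TWIN'S DOCUMENTATION FOLLOWS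
VERBATIM (its «levels 1 … k» / «Ω₁ = X» sentences describe the twin; here `j` runs from `0` and `Ω₁` may be a proper subset).

# `Balaban1983to89.B6CubeRightLegsV1` — T. Bałaban, *Propagators and renormalization transformations for lattice gauge theories. II*,
# Commun. Math. Phys. **96** (1984) 223–250 [Balaban1984PropagatorsII], (2.133)–(2.134) and (2.141) p. 247 with (2.91)–(2.94) p. 239:
# THE RIGHT LEGS OF THE CUBE MEMBERS FOR THE COLUMN WALK — `G_□·E_e` (`G_□∇_λ`, `G_□∇_λ*`) INPUT-LOCALISED, `G_□` OUTPUT-LOCALISED,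
# over the central reach `Q^T_□` with global decay (the twins of r03's `B6CubeInDecayV1` §4 `hEGin_cube` / `hGin_cube` in the other order)

statement-level skeleton of published theorems with citation tags; proofs where landed; nothing here is a claim about the Yang–Mills mass gap

PDF held: `paper:balaban1984-cmp96-propagators-rt-ii` (journal page = PDF page + 222): p. 247 [PDF 25] ((2.133): *"|(G_□J)(x)|, |(∇G_□J)(x)| ≤
O(1)[(L^jη)², L^jη]e^{−δ₂|y−y′|}|J|"*; (2.141): *"G = G₀(I − R)⁻¹ = Σ_{n=0}^∞ G₀Rⁿ = Σ_{ω=(□₀,…,□₂ₙ)} h_{□₀}G_{□₀}h_{□₀}·K_{□₁,□₂}G_{□₂}h_{□₂}· … ·K_{□₂ₙ₋₁,□₂ₙ}G_{□₂ₙ}h_{□₂ₙ}"*, *"and the series above is convergent in the norms appearing in the inequalities (2.136)–(2.140)"* — reading this walk on the COLUMNS of `G` (remainder transposed) is OURS (p38 g31's (2.136)₃ route), not displayed in print; (2.136)₃ *"|(G∇*J)(x)|"*), p. 239 [PDF 17] ((2.90)–(2.94)), p. 238 [PDF 16] (`□̃³ = T_□`);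
[Balaban1984PropagatorsI] (1.110) p. 35.  v1.1 (DOCFIX, family D-g75-1 of ref-4 gen 75): the v1.0 header paraphrased (2.141) with cut-offs `ζ` and
attributed a phrase *"their conjugates"* to p. 247 — neither is print; (2.141) is now quoted verbatim and the column reading labelled ours.  Lean unchanged.

CITATION HEADER (lean-in-tree rule) — WHAT IS REPRODUCED.  Phase-2 file of the `lit-balaban` typed skeleton (HOME `run/shared/lean/pub/lit-balaban/`),
unit `lit-balaban-p22` (gen 23), referee ref-4, B6 fold owner r03; SKELETON rows **B6.Eq2.133** × **B6.Eq2.134** × B6.Eq2.141 × B6.Prop2.6 (cells only;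
decls of record untouched).  p38 g31's ask (seat INBOX 2026-08-23T17:24:01Z, items (2)(a)(b)) for its (2.136)₃ TRANSPOSED-WALK route `G∇* = G₀ᵀ∇* +
Rᵀ(G∇*)`: the mirrored line-1 term `h·G_□·(M_□h_□ − h_□M_□)` is written with the differences adjacent to `G_□` ON THE RIGHT, so the member inputs are
`G_□E_e` for all `2(d+1)` legs (input-localised over the reach), and the mirrored line-2/line-4 pieces feed `G_□` from anywhere (output-localised
form).  IMPORTS BY NAME, restating nothing: r03's `…B6CubeInDecayV1` (`outMajorant_conj_chart`, the band data `hdiv_cube`, `hlev_full`, `hband_cube`,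
`sc_inv_le_pref`, `transplant_off`, the identities `Gl_eq`, `conj_mul`, `smul_kernel_le`), r03's `…B6InDecayWindowV1` (`inDecay_window_V1`,
`outDecay_window_V1`, `in/outMajorant_smul_of_le_on`), r05's `…B6InMajorantTransplant` (`InMajorant`, `inMajorant_conj_chart`), p22's F-lineage
`…B6Prop25GDivDecayTwoScaleV1.blockBound_GDadj_scaling` (`G_□∇_λ*`) and `…B6Ineq2133GDivLapTwoScaleV1.ineq2133_GDla`, p38's
`…B6Ineq2133TwoScaleV1` (`ineq2133_G`, `hasMajorant_of_blockBound`, `tsGeo`), p38's `…B6Eq292MemberTorusV1L0.EC`, r03's `…B6CubeWindowV1` (`Gl`, `tC`,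
`Placed`, `SQ`), `…B6BlockDecayHprimeCovV1.torusDist_blk_unshift_le_one`, `…B10StarCount.blockOf_shift`.

## WHAT THIS FILE CERTIFIES (kernel-checked, 0 sorry, standard axioms; theorems only — no `def`, no `def … : Prop`, no new named fact)

* §1 **`Gl_mul_EC_eq`** — `G_□·E_e = τ_{−v}(s(□)⁻¹•ε(G_□∘∇_e)ρ)τ_v` (r03's `EC_mul_Gl_eq` in the other order: `transplant_mul_of_bij` through the bijective
  window);
* §2 THE MEMBER RIGHT LEGS: `iterBlockOf_shift_or` (the block of `x + e_μ` is the block of `x` or its `μ`-neighbour, every scale — iterate of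
  `blockOf_shift`), `Dl_single_eq` (`∇_λe_{b′} = −∇_λ*e_{b′−e_λ}`), **`blockBound_GDl_scaling`** — NEW analytic bookkeeping: the block bound `(C, δ)` of
  `G_□∇_λ*` (p22 F14) gives `(C(1+e^δ), δ)` for `G_□∇_λ` (input shift by one fine bond: the shifted inputs of `B(y)` lie in `B(y) ∪ B(y − e_λ)`, a block at
  unit distance `≤ 1`), **`ineq2133_GDl`** (`HasMajorant (tsGeo i R M) y(·₋) (onFun (G_□ ∘ ∇_λ)) (A·e^{−δ|y−y′|_T})`), **`ineq2133_legs_right`** (both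
  right legs `G_□∇_λ`, `G_□∇_λ*` with ONE `(δ, A)`);
* §3 ON THE GLOBAL TORUS, for the genuine member of a placed cube (`L ≥ 5`, r03's quarter-point window): **`hGEin_cube`** — `∃ δ_G > 0, C_G ≥ 0` with
  `InMajorant (geomT D) (blkV1 hN D) (Gl □ * EC □ e) (Q^T_□) (C_G·(L^{j(y)}/c′)²·e^{−δ_G d_T(y,y′)})` for every `e : Fin (d+1) × Bool` (quantifier prefix of
  r03's `hEGin_cube` VERBATIM); **`hGout_cube`** — `OutMajorant (geomT D) (blkV1 hN D) (Gl □) (Q^T_□) (C_G·(L^{j(y)}/c′)²·e^{−δ_G d_T})` (prefix of r03's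
  `hGin_cube` verbatim; unfolded: `∀ y′ μ B, BlockSupp μ y′ B → ∀ x, blkV1 x ∈ Q^T_□ → |G_□μ x| ≤ C_G·pref(blkV1 x)·e^{−δ_G d_T(blkV1 x, y′)}·B`);
  **`hGEin_cube_sc`**, **`hGout_cube_sc`** — the same two in the RAW UNIFORM form, kernel `C_G·s(□)⁻¹·e^{−δ_G d_T}` with the cube's own unit
  `s(□)⁻¹ = (L^{j₀}/c′)²` (`B6CubeWindowV1L0.sc`) before `sc_inv_le_pref` (p38's request: the weight is then placed at the input block by the consumer).

## HONEST SCOPE / DIVERGENCES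

(1) Print states (2.133) for `G_□J`, `∇G_□J`, lists the right entry `|(G∇*J)(x)|` in (2.136) and asserts the convergence of the walk (2.141) in the
norms of (2.136)–(2.140); the column reading of (2.141) (p38 g31's route) and the explicit `G_□∇_λ` block bound by an input shift are OUR bookkeeping
(constant `C(1+e^δ)`, same rate).  (2) As in `B6CubeInDecayV1`: `L ≥ 5` (`ℓ ≥ 4`),
`M_h = L^a`, `R ≥ 2L²`, placed cube, rate `δ₂/(9(d+1))`, constants ours; the prefactor of `G_□E_e` is `(L^{j(y)}/c′)²` (the unit sits in p38's
coefficients).  (3) Integer torus, lattice units, p21's reading R2 of (2.46); nothing on (2.136)₃ itself, on d = 4 or the continuum; NOT summit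
progress.  (4) Theorems only; standard axioms.  Unit `lit-balaban-p22` (gen 23), 2026-08-23.
-/

noncomputable section

open scoped BigOperators
open Finset

namespace Literature.MathematicalPhysics.QuantumFieldTheory.Balaban1983to89.B6CubeRightLegsV1L0

open LatticeFieldCalculus
open B6RandomWalk (HasMajorant BlockSupp hasMajorant_mono)
open B6Prop26Gluing (mulOp LocalMajorant)
open B6InMajorantTransplant (InMajorant inMajorant_mono inMajorant_congr_set)
open B6InMajorantTransplantL0 (inMajorant_conj_chart)
open B6InDecayWindowV1 (OutMajorant outMajorant_mono outMajorant_congr_set inMajorant_smul_of_le_on outMajorant_smul_of_le_on transplant_apply_of_not_mem)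
open B6InDecayWindowV1L0 (inDecay_window_V1 outDecay_window_V1)
open B4Reflection242 (boxDom)
open B6MultiLevelBoxOperator (N0)
open B6MultiLevelTorusOperatorL0 (TDomains)
open B6Eq238MultiLevelTorus (svec)
open B6Cover236MultiLevelBlocksL0 (cubes)
open B6Geom246MultiLevelBoxL0 (bset)
open B6Partition118KLevelTorusCentral (one_le_of_four_le)
open B6GlobalChartV1 (PV toBox GlV1)
open B6GlobalChartV1L0 (blkV1 domT)
open B6AgreeLapV1Chart (cB eB posV mem_cB_W transplant_eB_eq GlV1_eq onFun_comp)
open B6Prop25TwoScaleCensus (TSIdx)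
open B6Prop26KLevelSkeletonV1L0 (ST pref pref_nonneg)
open B6Geom246MultiLevelTorusL0 (geomT blkMap)
open B6SectAOperatorsV1 (BondIdx)
open B6Ineq2133TwoScaleV1 (onFun onFun_apply tsGeo hasMajorant_of_blockBound ineq2133_G)
open B6Ineq2133GDivLapTwoScaleV1 (ineq2133_GDla)
open B6Prop25GDivDecayTwoScaleV1 (blockBound_GDadj_scaling)
open B6Prop26ReachTransplant (transplant transplant_mul_of_bij)
open B6TranslateTorusV1 (vch TB)
open B6TranslateTorusV1L0 (kernel_blkMap)
open B6Eq292MemberTorusV1L0 (EC)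
open B6CubeWindowV1 (x0 Placed)
open B6CubeWindowV1L0 (j0 tC sc hx0 hfit wC Gl SQ mem_SQ mem_blkMap_image_SQ)
open B6CubeInDecayV1 (conj_mul smul_kernel_le)
open B6CubeInDecayV1L0 (outMajorant_conj_chart hdiv_cube hlev_full hband_cube sc_inv_le_pref transplant_off Gl_eq sc_nonneg)
open B5Eq118OneStroke (iterBlockOf iterBlockOf_succ)

variable {d ℓ : ℕ} {hd : 1 ≤ d + 1} {hL : Odd (ℓ + 1) ∧ 1 < ℓ + 1} {a₀ a₁ : ℝ} {m K : ℕ} {Mh k R : ℕ} {P' : Fin (d + 1) → ℕ}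

/-! ## §1  `G_□·E_e` of the cube as a conjugated scaled transplant (r03's `EC_mul_Gl_eq` in the other order) -/

section Identity

variable (hN : ∀ μ, N0 ℓ Mh k P' μ = (PV d ℓ m K hd hL).sitesPerDir 0) {D : TDomains d ℓ Mh k P' R} (hk : k ≤ m + K)
  (hMh1 : 1 ≤ Mh) (hP4 : ∀ μ, 4 ≤ P' μ) {a : ℕ} (hMha : Mh = (ℓ + 1) ^ a) (c : ↥(cubes D.toDomains)) (ha : a₀ ≤ a₁)

/-- **`G_□·E_e` OF THE CUBE = `τ_{−v}(s(□)⁻¹•ε(G_□∘∇_e)ρ)τ_v`** (`∇_e = ∇_λ` or `∇_λ*`): the product of the two transplants through the BIJECTIVE window is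
the transplant of the product — r03's `B6CubeInDecayV1L0.EC_mul_Gl_eq` in the other order (the right legs of OUR column reading of the walk (2.141)).
[cite: Balaban1984PropagatorsII, (2.92) p.239 (line 1), (2.133), (2.141) p.247, p.238 (T_□ = □̃³), dictionary (charts); bookkeeping ours] -/
theorem Gl_mul_EC_eq (hpl : Placed ℓ k P' c.1) (w : BondIdx (B6GlobalChartV1L0.domT hN D hk) → ℝ) (cf : ℝ) (e : Fin (d + 1) × Bool) :
    Gl hN hk hMh1 hP4 hMha c ha hpl w cf * EC hN hk hMh1 hP4 hMha c ha hpl w cf e = TB (-vch Mh k (svec ℓ k c.1.1 c.1.2)) *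
      ((sc hMh1 hP4 c cf)⁻¹ • transplant (cB (tC hN hk hMh1 hP4 c ha a (wC hN hk c w) cf) (x0 ℓ Mh k c.1) (hx0 hpl) (hfit hN hMh1 hP4 hMha c ha hpl)).W
        (eB (tC hN hk hMh1 hP4 c ha a (wC hN hk c w) cf) (x0 ℓ Mh k c.1))
        (onFun ((tC hN hk hMh1 hP4 c ha a (wC hN hk c w) cf).D.G ∘ₗ
          (if e.2 then (tC hN hk hMh1 hP4 c ha a (wC hN hk c w) cf).Dl e.1 else (tC hN hk hMh1 hP4 c ha a (wC hN hk c w) cf).Dla e.1)))) *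
      TB (vch Mh k (svec ℓ k c.1.1 c.1.2)) := by
  rw [EC, Gl_eq, conj_mul, smul_mul_assoc, onFun_comp, ← Module.End.mul_eq_comp,
    transplant_mul_of_bij (W := (cB (tC hN hk hMh1 hP4 c ha a (wC hN hk c w) cf) (x0 ℓ Mh k c.1) (hx0 hpl) (hfit hN hMh1 hP4 hMha c ha hpl)).W)
      (e := eB (tC hN hk hMh1 hP4 c ha a (wC hN hk c w) cf) (x0 ℓ Mh k c.1))
      (cB (tC hN hk hMh1 hP4 c ha a (wC hN hk c w) cf) (x0 ℓ Mh k c.1) (hx0 hpl) (hfit hN hMh1 hP4 hMha c ha hpl)).inj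
      (cB (tC hN hk hMh1 hP4 c ha a (wC hN hk c w) cf) (x0 ℓ Mh k c.1) (hx0 hpl) (hfit hN hMh1 hP4 hMha c ha hpl)).surj]

end Identity


-- (§2 of the original — the member right legs over `TSIdx`, `D`-free — is opened BY NAME below)
open B6CubeRightLegsV1 (ineq2133_legs_right)

/-! ## §3  THE CUBE'S RIGHT LEGS ON THE GLOBAL TORUS: `hGEin_cube` (`G_□E_e`, input-localised), `hGout_cube` (`G_□`, output-localised) -/

section Cube

/-- **`hGE` FOR THE CUBE (INPUT-LOCALISED, GLOBAL DECAY): THE RIGHT LEGS `G_□·E_e`** (`e = (λ, ±)`: `G_□∇_λ`, `G_□∇_λ*`, p38's `EC`) have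
`InMajorant (geomT D) (blkV1 hN D) (G_□·E_e) (Q^T_□) (C·(L^{j(y)}/c′)²·e^{−δ_G d_T})`, one `(δ_G, C)` for all cubes and legs (`L ≥ 5`) — the mirror of
r03's `B6CubeInDecayV1L0.hEGin_cube` (`E_e·G_□`), same band bridge `inDecay_window_V1`, member input `ineq2133_legs_right`, identity `Gl_mul_EC_eq`; the
quantifier prefix is r03's VERBATIM. [cite: Balaban1984PropagatorsII, (2.133) p.247, (2.141) p.247 («h_{□₀}G_{□₀}h_{□₀}·K_{□₁,□₂}G_{□₂}h_{□₂}…», read on the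
columns — ours), (2.92) p.239 (line 1), (2.134) p.247] -/
theorem hGEin_cube (d ℓ : ℕ) (hd : 1 ≤ d + 1) (hL : Odd (ℓ + 1) ∧ 1 < ℓ + 1) {a₀ a₁ : ℝ} (ha₀ : 0 < a₀) (ha₁ : a₀ ≤ a₁) :
    ∃ δG : ℝ, 0 < δG ∧ ∃ CG : ℝ, 0 ≤ CG ∧ ∀ (m K : ℕ) {Mh k R : ℕ} {P' : Fin (d + 1) → ℕ}
      (hN : ∀ μ, N0 ℓ Mh k P' μ = (PV d ℓ m K hd hL).sitesPerDir 0) (D : TDomains d ℓ Mh k P' R) (hk : k ≤ m + K)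
      (hMh1 : 1 ≤ Mh) (hP4 : ∀ μ, 4 ≤ P' μ) {a : ℕ} (hMha : Mh = (ℓ + 1) ^ a) (_ : 2 ≤ Mh) (_ : 2 * (ℓ + 1) ^ 2 ≤ R) (_ : 4 ≤ ℓ)
      (c : ↥(cubes D.toDomains)) (hpl : Placed ℓ k P' c.1) (w : BondIdx (B6GlobalChartV1L0.domT hN D hk) → ℝ) (cf : ℝ) (e : Fin (d + 1) × Bool),
      InMajorant (g := geomT D) (blkV1 hN D) (Gl hN hk hMh1 hP4 hMha c ha₁ hpl w cf * EC hN hk hMh1 hP4 hMha c ha₁ hpl w cf e) (ST D hMh1 hP4 c)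
        (fun y y' => CG * pref cf y * Real.exp (-(δG * (geomT D).dist y y'))) := by
  obtain ⟨δ, hδ, A, hA, hmem⟩ := ineq2133_legs_right d (ℓ + 1) hd hL ha₀ ha₁
  refine ⟨δ / (((d : ℝ) + 1) * ((9 : ℕ) : ℝ)), by positivity,
    (((ℓ + 1) ^ (d + 1) : ℕ) : ℝ) * (A * Real.exp (δ * (((d : ℝ) + 1) + ((d : ℝ) + 1)) / (((d : ℝ) + 1) * ((9 : ℕ) : ℝ)))), by positivity, ?_⟩
  intro m K Mh k R P' hN D hk hMh1 hP4 a hMha hMh hR2 hℓ c hpl w cf e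
  have hP : ∀ μ, 1 ≤ P' μ := one_le_of_four_le hP4
  have h1 := inDecay_window_V1 (t := tC hN hk hMh1 hP4 c ha₁ a (wC hN hk c w) cf) (x₀ := x0 ℓ Mh k c.1) (hx₀ := hx0 hpl)
    (hfit := hfit hN hMh1 hP4 hMha c ha₁ hpl) hN (D.chart (svec ℓ k c.1.1 c.1.2)) hA hδ.le (hmem _ e) hMh1 hP
    (hdiv_cube hN hk hMh1 hP4 c ha₁ (wC hN hk c w) cf) (hlev_full hN hk hMh1 hP4 hMha c ha₁ hR2 (wC hN hk c w) cf) (C := 9) (by norm_num)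
    (SQ hMh1 hP4 c) (fun b _ hbS => hband_cube hN hk hMh1 hP4 hMha c ha₁ hℓ hMh hR2 (wC hN hk c w) cf b hbS)
  have h2 := inMajorant_smul_of_le_on (blkV1 hN (D.chart (svec ℓ k c.1.1 c.1.2))) h1 _
    (transplant_off hN hk hMh1 hP4 hMha c ha₁ hpl (wC hN hk c w) cf _) (inv_nonneg.2 (sc_nonneg hMh1 hP4 c cf))
    (K' := fun y y' => (((ℓ + 1) ^ (d + 1) : ℕ) : ℝ) * (A * Real.exp (δ * (((d : ℝ) + 1) + ((d : ℝ) + 1)) / (((d : ℝ) + 1) * ((9 : ℕ) : ℝ)))) *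
      pref cf y * Real.exp (-(δ / (((d : ℝ) + 1) * ((9 : ℕ) : ℝ)) * (geomT (D.chart (svec ℓ k c.1.1 c.1.2))).dist y y')))
    (fun a b => by have := pref_nonneg cf a; positivity)
    (fun b hb y _ => smul_kernel_le (sc_inv_le_pref hN hk hMh1 hP4 hMha c ha₁ hR2 hpl (wC hN hk c w) cf hb) (by positivity) (by positivity)
      (Real.exp_nonneg _))
  have h3 := inMajorant_conj_chart hN D hMh1 hP (svec ℓ k c.1.1 c.1.2) h2
    (K' := fun y y' => (((ℓ + 1) ^ (d + 1) : ℕ) : ℝ) * (A * Real.exp (δ * (((d : ℝ) + 1) + ((d : ℝ) + 1)) / (((d : ℝ) + 1) * ((9 : ℕ) : ℝ)))) *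
      pref cf y * Real.exp (-(δ / (((d : ℝ) + 1) * ((9 : ℕ) : ℝ)) * (geomT D).dist y y')))
    (fun a b => le_of_eq (kernel_blkMap D hMh1 hP (svec ℓ k c.1.1 c.1.2) (fun n => ((((ℓ + 1 : ℕ) : ℝ)) ^ n / cf) ^ 2) _ _ a b))
  rw [Gl_mul_EC_eq]
  exact inMajorant_congr_set _ (mem_blkMap_image_SQ hMh1 hP4 c) h3

/-- **`hGE` FOR THE CUBE IN THE RAW UNIFORM FORM** (p38 g31's request 18:29:12Z): the same input-localised majorant of `G_□·E_e` with the
two-scale estimate's own constant prefactor `s(□)⁻¹ = (L^{j₀}/c′)²` (BEFORE r03's `sc_inv_le_pref`), so that a consumer may place the weight at the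
INPUT block. [cite: Balaban1984PropagatorsII, (2.133), (2.141) p.247, (2.94) p.239 («s(□)» rescaling)] -/
theorem hGEin_cube_sc (d ℓ : ℕ) (hd : 1 ≤ d + 1) (hL : Odd (ℓ + 1) ∧ 1 < ℓ + 1) {a₀ a₁ : ℝ} (ha₀ : 0 < a₀) (ha₁ : a₀ ≤ a₁) :
    ∃ δG : ℝ, 0 < δG ∧ ∃ CG : ℝ, 0 ≤ CG ∧ ∀ (m K : ℕ) {Mh k R : ℕ} {P' : Fin (d + 1) → ℕ}
      (hN : ∀ μ, N0 ℓ Mh k P' μ = (PV d ℓ m K hd hL).sitesPerDir 0) (D : TDomains d ℓ Mh k P' R) (hk : k ≤ m + K)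
      (hMh1 : 1 ≤ Mh) (hP4 : ∀ μ, 4 ≤ P' μ) {a : ℕ} (hMha : Mh = (ℓ + 1) ^ a) (_ : 2 ≤ Mh) (_ : 2 * (ℓ + 1) ^ 2 ≤ R) (_ : 4 ≤ ℓ)
      (c : ↥(cubes D.toDomains)) (hpl : Placed ℓ k P' c.1) (w : BondIdx (B6GlobalChartV1L0.domT hN D hk) → ℝ) (cf : ℝ) (e : Fin (d + 1) × Bool),
      InMajorant (g := geomT D) (blkV1 hN D) (Gl hN hk hMh1 hP4 hMha c ha₁ hpl w cf * EC hN hk hMh1 hP4 hMha c ha₁ hpl w cf e) (ST D hMh1 hP4 c)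
        (fun y y' => CG * (sc hMh1 hP4 c cf)⁻¹ * Real.exp (-(δG * (geomT D).dist y y'))) := by
  obtain ⟨δ, hδ, A, hA, hmem⟩ := ineq2133_legs_right d (ℓ + 1) hd hL ha₀ ha₁
  refine ⟨δ / (((d : ℝ) + 1) * ((9 : ℕ) : ℝ)), by positivity,
    (((ℓ + 1) ^ (d + 1) : ℕ) : ℝ) * (A * Real.exp (δ * (((d : ℝ) + 1) + ((d : ℝ) + 1)) / (((d : ℝ) + 1) * ((9 : ℕ) : ℝ)))), by positivity, ?_⟩
  intro m K Mh k R P' hN D hk hMh1 hP4 a hMha hMh hR2 hℓ c hpl w cf e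
  have hP : ∀ μ, 1 ≤ P' μ := one_le_of_four_le hP4
  have h1 := inDecay_window_V1 (t := tC hN hk hMh1 hP4 c ha₁ a (wC hN hk c w) cf) (x₀ := x0 ℓ Mh k c.1) (hx₀ := hx0 hpl)
    (hfit := hfit hN hMh1 hP4 hMha c ha₁ hpl) hN (D.chart (svec ℓ k c.1.1 c.1.2)) hA hδ.le (hmem _ e) hMh1 hP
    (hdiv_cube hN hk hMh1 hP4 c ha₁ (wC hN hk c w) cf) (hlev_full hN hk hMh1 hP4 hMha c ha₁ hR2 (wC hN hk c w) cf) (C := 9) (by norm_num)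
    (SQ hMh1 hP4 c) (fun b _ hbS => hband_cube hN hk hMh1 hP4 hMha c ha₁ hℓ hMh hR2 (wC hN hk c w) cf b hbS)
  have h2 := inMajorant_smul_of_le_on (blkV1 hN (D.chart (svec ℓ k c.1.1 c.1.2))) h1 _
    (transplant_off hN hk hMh1 hP4 hMha c ha₁ hpl (wC hN hk c w) cf _) (inv_nonneg.2 (sc_nonneg hMh1 hP4 c cf))
    (K' := fun y y' => (((ℓ + 1) ^ (d + 1) : ℕ) : ℝ) * (A * Real.exp (δ * (((d : ℝ) + 1) + ((d : ℝ) + 1)) / (((d : ℝ) + 1) * ((9 : ℕ) : ℝ)))) *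
      (sc hMh1 hP4 c cf)⁻¹ * Real.exp (-(δ / (((d : ℝ) + 1) * ((9 : ℕ) : ℝ)) * (geomT (D.chart (svec ℓ k c.1.1 c.1.2))).dist y y')))
    (fun a b => by have := sc_nonneg hMh1 hP4 c cf; positivity)
    (fun b _ y _ => smul_kernel_le le_rfl (by positivity) (by positivity) (Real.exp_nonneg _))
  have h3 := inMajorant_conj_chart hN D hMh1 hP (svec ℓ k c.1.1 c.1.2) h2
    (K' := fun y y' => (((ℓ + 1) ^ (d + 1) : ℕ) : ℝ) * (A * Real.exp (δ * (((d : ℝ) + 1) + ((d : ℝ) + 1)) / (((d : ℝ) + 1) * ((9 : ℕ) : ℝ)))) *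
      (sc hMh1 hP4 c cf)⁻¹ * Real.exp (-(δ / (((d : ℝ) + 1) * ((9 : ℕ) : ℝ)) * (geomT D).dist y y')))
    (fun a b => le_of_eq (kernel_blkMap D hMh1 hP (svec ℓ k c.1.1 c.1.2) (fun _ => (sc hMh1 hP4 c cf)⁻¹) _ _ a b))
  rw [Gl_mul_EC_eq]
  exact inMajorant_congr_set _ (mem_blkMap_image_SQ hMh1 hP4 c) h3

/-- **`hGout` FOR THE CUBE: THE GENUINE `G_□` HAS AN OUTPUT-LOCALISED MAJORANT OVER `Q^T_□` WITH GLOBAL DECAY AND PRINT'S PREFACTOR** (`L ≥ 5`):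
`OutMajorant (geomT D) (blkV1 hN D) (G_□) (Q^T_□) (C_G·(L^{j(y)}/c′)²·e^{−δ_G d_T(y,y′)})` — outputs over the central reach, inputs ANYWHERE; the twin
of r03's `B6CubeInDecayV1L0.hGin_cube` through `outDecay_window_V1` (same constants `δ_G = δ₂/(9(d+1))`, `C_G = L^{d+1}·A·e^{2δ₂/9}`).  Unfolded:
`∀ y′ μ B, BlockSupp (blkV1 hN D) μ y′ B → ∀ x, blkV1 hN D x ∈ Q^T_□ → |G_□ μ x| ≤ C_G·pref c′ (blkV1 hN D x)·e^{−δ_G d_T(blkV1 hN D x, y′)}·B`.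
[cite: Balaban1984PropagatorsII, (2.133) p.247, (2.134) p.247, (2.141) p.247, (2.90)–(2.94) p.239] -/
theorem hGout_cube (d ℓ : ℕ) (hd : 1 ≤ d + 1) (hL : Odd (ℓ + 1) ∧ 1 < ℓ + 1) {a₀ a₁ : ℝ} (ha₀ : 0 < a₀) (ha₁ : a₀ ≤ a₁) :
    ∃ δG : ℝ, 0 < δG ∧ ∃ CG : ℝ, 0 ≤ CG ∧ ∀ (m K : ℕ) {Mh k R : ℕ} {P' : Fin (d + 1) → ℕ}
      (hN : ∀ μ, N0 ℓ Mh k P' μ = (PV d ℓ m K hd hL).sitesPerDir 0) (D : TDomains d ℓ Mh k P' R) (hk : k ≤ m + K)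
      (hMh1 : 1 ≤ Mh) (hP4 : ∀ μ, 4 ≤ P' μ) {a : ℕ} (hMha : Mh = (ℓ + 1) ^ a) (_ : 2 ≤ Mh) (_ : 2 * (ℓ + 1) ^ 2 ≤ R) (_ : 4 ≤ ℓ)
      (c : ↥(cubes D.toDomains)) (hpl : Placed ℓ k P' c.1) (w : BondIdx (B6GlobalChartV1L0.domT hN D hk) → ℝ) (cf : ℝ),
      OutMajorant (g := geomT D) (blkV1 hN D) (Gl hN hk hMh1 hP4 hMha c ha₁ hpl w cf) (ST D hMh1 hP4 c)
        (fun y y' => CG * pref cf y * Real.exp (-(δG * (geomT D).dist y y'))) := by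
  obtain ⟨δ, hδ, A, hA, hmem⟩ := ineq2133_G d (ℓ + 1) hd hL ha₀ ha₁
  refine ⟨δ / (((d : ℝ) + 1) * ((9 : ℕ) : ℝ)), by positivity,
    (((ℓ + 1) ^ (d + 1) : ℕ) : ℝ) * (A * Real.exp (δ * (((d : ℝ) + 1) + ((d : ℝ) + 1)) / (((d : ℝ) + 1) * ((9 : ℕ) : ℝ)))), by positivity, ?_⟩
  intro m K Mh k R P' hN D hk hMh1 hP4 a hMha hMh hR2 hℓ c hpl w cf
  have hP : ∀ μ, 1 ≤ P' μ := one_le_of_four_le hP4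
  have h1 := outDecay_window_V1 (t := tC hN hk hMh1 hP4 c ha₁ a (wC hN hk c w) cf) (x₀ := x0 ℓ Mh k c.1) (hx₀ := hx0 hpl)
    (hfit := hfit hN hMh1 hP4 hMha c ha₁ hpl) hN (D.chart (svec ℓ k c.1.1 c.1.2)) hA hδ.le (hmem _ 0 0) hMh1 hP
    (hdiv_cube hN hk hMh1 hP4 c ha₁ (wC hN hk c w) cf) (hlev_full hN hk hMh1 hP4 hMha c ha₁ hR2 (wC hN hk c w) cf) (C := 9) (by norm_num)
    (SQ hMh1 hP4 c) (fun b _ hbS => hband_cube hN hk hMh1 hP4 hMha c ha₁ hℓ hMh hR2 (wC hN hk c w) cf b hbS)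
  have h2 := outMajorant_smul_of_le_on (blkV1 hN (D.chart (svec ℓ k c.1.1 c.1.2))) h1 _
    (transplant_off hN hk hMh1 hP4 hMha c ha₁ hpl (wC hN hk c w) cf _) (inv_nonneg.2 (sc_nonneg hMh1 hP4 c cf))
    (K' := fun y y' => (((ℓ + 1) ^ (d + 1) : ℕ) : ℝ) * (A * Real.exp (δ * (((d : ℝ) + 1) + ((d : ℝ) + 1)) / (((d : ℝ) + 1) * ((9 : ℕ) : ℝ)))) *
      pref cf y * Real.exp (-(δ / (((d : ℝ) + 1) * ((9 : ℕ) : ℝ)) * (geomT (D.chart (svec ℓ k c.1.1 c.1.2))).dist y y')))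
    (fun a b => by have := pref_nonneg cf a; positivity)
    (fun b hb _ y => smul_kernel_le (sc_inv_le_pref hN hk hMh1 hP4 hMha c ha₁ hR2 hpl (wC hN hk c w) cf hb) (by positivity) (by positivity)
      (Real.exp_nonneg _))
  have h3 := outMajorant_conj_chart hN D hMh1 hP (svec ℓ k c.1.1 c.1.2) h2
    (K' := fun y y' => (((ℓ + 1) ^ (d + 1) : ℕ) : ℝ) * (A * Real.exp (δ * (((d : ℝ) + 1) + ((d : ℝ) + 1)) / (((d : ℝ) + 1) * ((9 : ℕ) : ℝ)))) *
      pref cf y * Real.exp (-(δ / (((d : ℝ) + 1) * ((9 : ℕ) : ℝ)) * (geomT D).dist y y')))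
    (fun a b => le_of_eq (kernel_blkMap D hMh1 hP (svec ℓ k c.1.1 c.1.2) (fun n => ((((ℓ + 1 : ℕ) : ℝ)) ^ n / cf) ^ 2) _ _ a b))
  rw [Gl_eq]
  exact outMajorant_congr_set _ (mem_blkMap_image_SQ hMh1 hP4 c) h3

/-- **`hGout` FOR THE CUBE IN THE RAW UNIFORM FORM** (p38 g31's request 18:29:12Z): the output-localised majorant of `G_□` with the constant
prefactor `s(□)⁻¹ = (L^{j₀}/c′)²`. [cite: Balaban1984PropagatorsII, (2.133), (2.141) p.247, (2.94) p.239] -/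
theorem hGout_cube_sc (d ℓ : ℕ) (hd : 1 ≤ d + 1) (hL : Odd (ℓ + 1) ∧ 1 < ℓ + 1) {a₀ a₁ : ℝ} (ha₀ : 0 < a₀) (ha₁ : a₀ ≤ a₁) :
    ∃ δG : ℝ, 0 < δG ∧ ∃ CG : ℝ, 0 ≤ CG ∧ ∀ (m K : ℕ) {Mh k R : ℕ} {P' : Fin (d + 1) → ℕ}
      (hN : ∀ μ, N0 ℓ Mh k P' μ = (PV d ℓ m K hd hL).sitesPerDir 0) (D : TDomains d ℓ Mh k P' R) (hk : k ≤ m + K)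
      (hMh1 : 1 ≤ Mh) (hP4 : ∀ μ, 4 ≤ P' μ) {a : ℕ} (hMha : Mh = (ℓ + 1) ^ a) (_ : 2 ≤ Mh) (_ : 2 * (ℓ + 1) ^ 2 ≤ R) (_ : 4 ≤ ℓ)
      (c : ↥(cubes D.toDomains)) (hpl : Placed ℓ k P' c.1) (w : BondIdx (B6GlobalChartV1L0.domT hN D hk) → ℝ) (cf : ℝ),
      OutMajorant (g := geomT D) (blkV1 hN D) (Gl hN hk hMh1 hP4 hMha c ha₁ hpl w cf) (ST D hMh1 hP4 c)
        (fun y y' => CG * (sc hMh1 hP4 c cf)⁻¹ * Real.exp (-(δG * (geomT D).dist y y'))) := by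
  obtain ⟨δ, hδ, A, hA, hmem⟩ := ineq2133_G d (ℓ + 1) hd hL ha₀ ha₁
  refine ⟨δ / (((d : ℝ) + 1) * ((9 : ℕ) : ℝ)), by positivity,
    (((ℓ + 1) ^ (d + 1) : ℕ) : ℝ) * (A * Real.exp (δ * (((d : ℝ) + 1) + ((d : ℝ) + 1)) / (((d : ℝ) + 1) * ((9 : ℕ) : ℝ)))), by positivity, ?_⟩
  intro m K Mh k R P' hN D hk hMh1 hP4 a hMha hMh hR2 hℓ c hpl w cf
  have hP : ∀ μ, 1 ≤ P' μ := one_le_of_four_le hP4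
  have h1 := outDecay_window_V1 (t := tC hN hk hMh1 hP4 c ha₁ a (wC hN hk c w) cf) (x₀ := x0 ℓ Mh k c.1) (hx₀ := hx0 hpl)
    (hfit := hfit hN hMh1 hP4 hMha c ha₁ hpl) hN (D.chart (svec ℓ k c.1.1 c.1.2)) hA hδ.le (hmem _ 0 0) hMh1 hP
    (hdiv_cube hN hk hMh1 hP4 c ha₁ (wC hN hk c w) cf) (hlev_full hN hk hMh1 hP4 hMha c ha₁ hR2 (wC hN hk c w) cf) (C := 9) (by norm_num)
    (SQ hMh1 hP4 c) (fun b _ hbS => hband_cube hN hk hMh1 hP4 hMha c ha₁ hℓ hMh hR2 (wC hN hk c w) cf b hbS)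
  have h2 := outMajorant_smul_of_le_on (blkV1 hN (D.chart (svec ℓ k c.1.1 c.1.2))) h1 _
    (transplant_off hN hk hMh1 hP4 hMha c ha₁ hpl (wC hN hk c w) cf _) (inv_nonneg.2 (sc_nonneg hMh1 hP4 c cf))
    (K' := fun y y' => (((ℓ + 1) ^ (d + 1) : ℕ) : ℝ) * (A * Real.exp (δ * (((d : ℝ) + 1) + ((d : ℝ) + 1)) / (((d : ℝ) + 1) * ((9 : ℕ) : ℝ)))) *
      (sc hMh1 hP4 c cf)⁻¹ * Real.exp (-(δ / (((d : ℝ) + 1) * ((9 : ℕ) : ℝ)) * (geomT (D.chart (svec ℓ k c.1.1 c.1.2))).dist y y')))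
    (fun a b => by have := sc_nonneg hMh1 hP4 c cf; positivity)
    (fun b _ _ y => smul_kernel_le le_rfl (by positivity) (by positivity) (Real.exp_nonneg _))
  have h3 := outMajorant_conj_chart hN D hMh1 hP (svec ℓ k c.1.1 c.1.2) h2
    (K' := fun y y' => (((ℓ + 1) ^ (d + 1) : ℕ) : ℝ) * (A * Real.exp (δ * (((d : ℝ) + 1) + ((d : ℝ) + 1)) / (((d : ℝ) + 1) * ((9 : ℕ) : ℝ)))) *
      (sc hMh1 hP4 c cf)⁻¹ * Real.exp (-(δ / (((d : ℝ) + 1) * ((9 : ℕ) : ℝ)) * (geomT D).dist y y')))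
    (fun a b => le_of_eq (kernel_blkMap D hMh1 hP (svec ℓ k c.1.1 c.1.2) (fun _ => (sc hMh1 hP4 c cf)⁻¹) _ _ a b))
  rw [Gl_eq]
  exact outMajorant_congr_set _ (mem_blkMap_image_SQ hMh1 hP4 c) h3

end Cube

end Literature.MathematicalPhysics.QuantumFieldTheory.Balaban1983to89.B6CubeRightLegsV1L0
end
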